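import Summits.CriticalPhenomena.Ising3D.OddTailConversionAlgebra
import Summits.CriticalPhenomena.Ising3D.TaylorCoeffZMono
import Mathlib.Tactic.Linarith
import Mathlib.Tactic.Positivity
import Mathlib.Tactic.Ring
import HarnessLib

/-!
# Euler–rapidity weights: Taylor functionals diagonal on the Legendre monomials
(cell `pub-ising3x`, seat recog-1 gen 9; ingredient (T4) of the proposed reduction of gate (g1) of
M3-γ, HOME/pub-ising3x-recog-1/gen9/G1-REDUCTION.md)

HONEST FRAMING: lottery ticket; floor = tightest certified 3D Ising CFT bounds; no exact-solution
claim without a proof.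

`eulerWeight₁ x p a = x^a · a! · S(p,a)` are the Taylor-coefficient weights of `(x∂ₓ)^p` at `x`: on
the germ of `t ↦ t^α` (`rpowGerm`) they return `α^p x^α` (`sum_eulerWeight₁_mul_rpowGerm`, from the
Stirling normal-ordering identity of `OddTailConversionAlgebra`). Products of two weight vectors give
Taylor functionals at `(x,x)` with value `α^p β^q x^{α+β}` on `s^α t^β`; on the Legendre monomial
`𝒫_{E,j}` (`zMono`, a non-negative combination of `s^{α₁} t^{α₂}` with `α₁ + α₂ = E`,
`α₁ - α₂ = p₁ - p₂`; Taylor coefficients from boot-1's `taylorCoeffAt_crossF_zMono` at `s = σ = 0`)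
the binomially symmetrised weights `eulerRapidityWeight x m k` of `(x∂ₓ + y∂_y)^m (x∂ₓ - y∂_y)^{2k}`
evaluate to `x^E · E^m · hMoment k j ≥ 0` (`sum_eulerRapidityWeight_taylorCoeffAt_zMono`). This is
the positivity that converts `A(-c,-c)`-weighted odd-sector tails into `A(c,c)`-weighted ones
(G1-REDUCTION.md, Lemma B); the termwise/`HasSum` layer is the tree's TaylorFunctional machinery and
is not repeated here. Finite sums only; no `decide`. Sources: elementary.
-/

namespace Summit.CriticalPhenomena.Ising3D

open Finset
open Literature.MathematicalPhysics.QuantumFieldTheory.ConformalBootstrap3D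

/-! ### One-variable Euler weights -/

/-- The one-variable Euler weights `x^a · a! · S(p,a)`. [folklore] -/
noncomputable def eulerWeight₁ (x : ℝ) (p a : ℕ) : ℝ :=
  x ^ a * (a.factorial : ℝ) * (stirling₂ p a : ℝ)

/-- `rpowGerm α x a = x^α · C(α,a) · x^{-a}` (the two signs of the tree's definition cancel).
[folklore] -/
theorem rpowGerm_eq_choose (α x : ℝ) (a : ℕ) :
    rpowGerm α x a = x ^ α * Ring.choose α a * (x⁻¹) ^ a := by
  rw [rpowGerm_eq]
  have : ((-1 : ℝ) ^ a * Ring.choose α a) * (-x⁻¹) ^ a = Ring.choose α a * (x⁻¹) ^ a := by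
    rw [show (-x⁻¹) = (-1) * x⁻¹ by ring, mul_pow]
    have h1 : ((-1 : ℝ) ^ a) * ((-1 : ℝ) ^ a) = 1 := by rw [← mul_pow]; norm_num
    calc (-1 : ℝ) ^ a * Ring.choose α a * ((-1) ^ a * (x⁻¹) ^ a)
        = ((-1 : ℝ) ^ a * (-1) ^ a) * (Ring.choose α a * (x⁻¹) ^ a) := by ring
      _ = Ring.choose α a * (x⁻¹) ^ a := by rw [h1, one_mul]
  rw [mul_assoc, this, ← mul_assoc]

/-- The normal-ordering identity on a larger range: for `p ≤ N`,
`Σ_{a ≤ N} S(p,a) · a! · C(α,a) = α^p`. [folklore] -/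
theorem sum_range_stirling₂_mul_factorial_mul_choose {p N : ℕ} (hpN : p ≤ N) (α : ℝ) :
    ∑ a ∈ range (N + 1), (stirling₂ p a : ℝ) * ((a.factorial : ℝ) * Ring.choose α a) = α ^ p := by
  rw [← sum_stirling₂_mul_factorial_mul_choose p α]
  symm
  refine Finset.sum_subset (fun a ha => ?_) (fun a _ ha' => ?_)
  · simp only [Finset.mem_range] at ha ⊢; omega
  · simp only [Finset.mem_range, not_lt] at ha'
    rw [stirling₂_eq_zero_of_lt (by omega)]
    simp

/-- **`(x∂ₓ)^p` on `t^α`, at the level of Taylor coefficients**: for `x ≠ 0` and `p ≤ N`,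
`Σ_{a ≤ N} eulerWeight₁ x p a · rpowGerm α x a = α^p · x^α`. [folklore] -/
theorem sum_eulerWeight₁_mul_rpowGerm {x : ℝ} (hx : x ≠ 0) {p N : ℕ} (hpN : p ≤ N) (α : ℝ) :
    ∑ a ∈ range (N + 1), eulerWeight₁ x p a * rpowGerm α x a = α ^ p * x ^ α := by
  have h : ∀ a ∈ range (N + 1), eulerWeight₁ x p a * rpowGerm α x a =
      x ^ α * ((stirling₂ p a : ℝ) * ((a.factorial : ℝ) * Ring.choose α a)) := by
    intro a _
    rw [eulerWeight₁, rpowGerm_eq_choose]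
    have hxa : x ^ a * (x⁻¹) ^ a = 1 := by rw [← mul_pow, mul_inv_cancel₀ hx, one_pow]
    calc x ^ a * (a.factorial : ℝ) * (stirling₂ p a : ℝ) * (x ^ α * Ring.choose α a * (x⁻¹) ^ a)
        = (x ^ a * (x⁻¹) ^ a) * (x ^ α * ((stirling₂ p a : ℝ) * ((a.factorial : ℝ) * Ring.choose α a))) := by
          ring
      _ = _ := by rw [hxa, one_mul]
  rw [Finset.sum_congr rfl h, ← Finset.mul_sum, sum_range_stirling₂_mul_factorial_mul_choose hpN, mul_comm]

/-- **Two variables**: the product weights act on `s^α t^β` as `α^p β^q x^{α+β}` (`0 < x`). [folklore] -/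
theorem sum_eulerWeight₁_prod_mul_rpowGerm {x : ℝ} (hx : 0 < x) {p q N : ℕ} (hpN : p ≤ N) (hqN : q ≤ N)
    (α β : ℝ) :
    ∑ a ∈ range (N + 1), ∑ b ∈ range (N + 1),
        eulerWeight₁ x p a * eulerWeight₁ x q b * (rpowGerm α x a * rpowGerm β x b) =
      α ^ p * β ^ q * x ^ (α + β) := by
  have hx0 : x ≠ 0 := hx.ne'
  calc ∑ a ∈ range (N + 1), ∑ b ∈ range (N + 1),
          eulerWeight₁ x p a * eulerWeight₁ x q b * (rpowGerm α x a * rpowGerm β x b)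
      = ∑ a ∈ range (N + 1), (eulerWeight₁ x p a * rpowGerm α x a) *
          ∑ b ∈ range (N + 1), eulerWeight₁ x q b * rpowGerm β x b := by
        refine Finset.sum_congr rfl fun a _ => ?_
        rw [Finset.mul_sum]
        refine Finset.sum_congr rfl fun b _ => ?_
        ring
    _ = (α ^ p * x ^ α) * (β ^ q * x ^ β) := by
        rw [sum_eulerWeight₁_mul_rpowGerm hx0 hqN β, ← Finset.sum_mul, sum_eulerWeight₁_mul_rpowGerm hx0 hpN α]
    _ = α ^ p * β ^ q * x ^ (α + β) := by
        rw [Real.rpow_add hx]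
        ring

/-- At exponent `0` the `(1-t)^0` germ is trivial: `oneSubGerm 0 x i = [i = 0]`. [folklore] -/
theorem oneSubGerm_zero_left (x : ℝ) (i : ℕ) : oneSubGerm 0 x i = if i = 0 then 1 else 0 := by
  rw [oneSubGerm_eq, Real.rpow_zero, one_mul]
  rcases Nat.eq_zero_or_pos i with rfl | hi
  · simp
  · obtain ⟨i', rfl⟩ : ∃ i', i = i' + 1 := ⟨i - 1, by omega⟩
    rw [Ring.choose_zero_succ]
    simp

/-- Hence the term-1 factor germ at `s = 0` is the bare `t^α` germ. [folklore] -/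
theorem factor₁Germ_zero (α x : ℝ) (a : ℕ) : factor₁Germ 0 α x a = rpowGerm α x a := by
  unfold factor₁Germ
  rw [Finset.Nat.sum_antidiagonal_eq_sum_range_succ (fun i j => oneSubGerm 0 x i * rpowGerm α x j)]
  rw [Finset.sum_range_succ']
  simp only [oneSubGerm_zero_left, Nat.succ_ne_zero, if_false, zero_mul, Finset.sum_const_zero, zero_add,
    if_true, one_mul, Nat.sub_zero]

/-- `crossF 0 0 g = g`: with exponent `0` and sign `0` the crossing wrapper is the identity. [folklore] -/
theorem crossF_zero_zero (g : ℝ → ℝ → ℝ) : crossF 0 0 g = g := by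
  funext z zb
  simp [crossF, Real.rpow_zero]

/-- **The Euler–rapidity functionals on the Legendre monomials.** For `0 < x < 1`, `j ≤ E`,
`p, q ≤ N`: `Σ_{a,b ≤ N} e_p(a) e_q(b) · taylorCoeffAt x x (a,b) 𝒫_{E,j}
 = x^E · Σ_{p₁+p₂=j} λ_{p₁} λ_{p₂} ((E-j)/2 + p₁)^p ((E-j)/2 + p₂)^q`.
In particular the symmetrised weights for `(α₁+α₂)^m (α₁-α₂)^{2k}` give `x^E · E^m · hMoment k j ≥ 0`
(`α₁ + α₂ = E`, `α₁ - α₂ = p₁ - p₂`). [folklore] -/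
theorem sum_eulerWeight₁_prod_taylorCoeffAt_zMono {x : ℝ} (hx0 : 0 < x) (hx1 : x < 1) {E : ℝ} {j : ℕ}
    (hEj : (j : ℝ) ≤ E) {p q N : ℕ} (hpN : p ≤ N) (hqN : q ≤ N) :
    ∑ a ∈ range (N + 1), ∑ b ∈ range (N + 1),
        eulerWeight₁ x p a * eulerWeight₁ x q b * taylorCoeffAt x x (a, b) (zMono E j) =
      x ^ E * ∑ c ∈ antidiagonal j, legendreLam c.1 * legendreLam c.2 *
        (((E - (j : ℝ)) / 2 + c.1) ^ p * ((E - (j : ℝ)) / 2 + c.2) ^ q) := by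
  -- Taylor coefficients of 𝒫_{E,j} = crossF 0 0 𝒫_{E,j}
  have hT : ∀ a b : ℕ, taylorCoeffAt x x (a, b) (zMono E j) =
      ∑ c ∈ antidiagonal j, legendreLam c.1 * legendreLam c.2 *
        (rpowGerm ((E - (j : ℝ)) / 2 + c.1) x a * rpowGerm ((E - (j : ℝ)) / 2 + c.2) x b) := by
    intro a b
    have h := taylorCoeffAt_crossF_zMono hx0 hx1 0 0 E j hEj (a, b)
    rw [crossF_zero_zero] at h
    rw [h]
    refine Finset.sum_congr rfl fun c _ => ?_
    simp only [factor₁Germ_zero, zero_mul, add_zero]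
  -- swap the finite sums and use the product identity termwise in `c`
  calc ∑ a ∈ range (N + 1), ∑ b ∈ range (N + 1),
          eulerWeight₁ x p a * eulerWeight₁ x q b * taylorCoeffAt x x (a, b) (zMono E j)
      = ∑ a ∈ range (N + 1), ∑ b ∈ range (N + 1), ∑ c ∈ antidiagonal j,
          legendreLam c.1 * legendreLam c.2 * (eulerWeight₁ x p a * eulerWeight₁ x q b *
            (rpowGerm ((E - (j : ℝ)) / 2 + c.1) x a * rpowGerm ((E - (j : ℝ)) / 2 + c.2) x b)) := by
        refine Finset.sum_congr rfl fun a _ => Finset.sum_congr rfl fun b _ => ?_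
        rw [hT a b, Finset.mul_sum]
        refine Finset.sum_congr rfl fun c _ => ?_
        ring
    _ = ∑ a ∈ range (N + 1), ∑ c ∈ antidiagonal j, ∑ b ∈ range (N + 1),
          legendreLam c.1 * legendreLam c.2 * (eulerWeight₁ x p a * eulerWeight₁ x q b *
            (rpowGerm ((E - (j : ℝ)) / 2 + c.1) x a * rpowGerm ((E - (j : ℝ)) / 2 + c.2) x b)) :=
        Finset.sum_congr rfl fun a _ => Finset.sum_comm
    _ = ∑ c ∈ antidiagonal j, ∑ a ∈ range (N + 1), ∑ b ∈ range (N + 1),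
          legendreLam c.1 * legendreLam c.2 * (eulerWeight₁ x p a * eulerWeight₁ x q b *
            (rpowGerm ((E - (j : ℝ)) / 2 + c.1) x a * rpowGerm ((E - (j : ℝ)) / 2 + c.2) x b)) :=
        Finset.sum_comm
    _ = ∑ c ∈ antidiagonal j, legendreLam c.1 * legendreLam c.2 *
          ∑ a ∈ range (N + 1), ∑ b ∈ range (N + 1), eulerWeight₁ x p a * eulerWeight₁ x q b *
            (rpowGerm ((E - (j : ℝ)) / 2 + c.1) x a * rpowGerm ((E - (j : ℝ)) / 2 + c.2) x b) := by
        refine Finset.sum_congr rfl fun c _ => ?_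
        rw [Finset.mul_sum]
        refine Finset.sum_congr rfl fun a _ => ?_
        rw [Finset.mul_sum]
    _ = x ^ E * ∑ c ∈ antidiagonal j, legendreLam c.1 * legendreLam c.2 *
        (((E - (j : ℝ)) / 2 + c.1) ^ p * ((E - (j : ℝ)) / 2 + c.2) ^ q) := by
        rw [Finset.mul_sum]
        refine Finset.sum_congr rfl fun c hc => ?_
        rw [sum_eulerWeight₁_prod_mul_rpowGerm hx0 hpN hqN]
        have hsum : (E - (j : ℝ)) / 2 + c.1 + ((E - (j : ℝ)) / 2 + c.2) = E := by
          have := mem_antidiagonal.mp hc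
          have : ((c.1 : ℝ) + c.2) = j := by exact_mod_cast this
          linarith
        rw [hsum]
        ring

/-- The Euler–rapidity weights of order `(m, 2k)`: the Taylor-coefficient weights at `(x,x)` of
`(x∂ₓ + y∂_y)^m (x∂ₓ - y∂_y)^{2k}`, assembled from the one-variable Euler weights by the binomial
theorem (`(α+β)^m (α-β)^{2k} = Σ_{u,w} C(m,u) C(2k,w) (-1)^w α^{u+w} β^{(m-u)+(2k-w)}`). [folklore] -/
noncomputable def eulerRapidityWeight (x : ℝ) (m k a b : ℕ) : ℝ :=
  ∑ u ∈ range (m + 1), ∑ w ∈ range (2 * k + 1),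
    (m.choose u : ℝ) * ((2 * k).choose w : ℝ) * (-1) ^ w *
      (eulerWeight₁ x (u + w) a * eulerWeight₁ x (m - u + (2 * k - w)) b)

/-- Binomial bookkeeping: `Σ_{u ≤ m} Σ_{w ≤ 2k} C(m,u) C(2k,w) (-1)^w α^{u+w} β^{(m-u)+(2k-w)}
 = (α+β)^m (α-β)^{2k}`. [folklore] -/
theorem sum_choose_mul_pow_eq (m k : ℕ) (α β : ℝ) :
    ∑ u ∈ range (m + 1), ∑ w ∈ range (2 * k + 1),
        (m.choose u : ℝ) * ((2 * k).choose w : ℝ) * (-1) ^ w * (α ^ (u + w) * β ^ (m - u + (2 * k - w))) =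
      (α + β) ^ m * (α - β) ^ (2 * k) := by
  have h1 : (α + β) ^ m = ∑ u ∈ range (m + 1), α ^ u * β ^ (m - u) * (m.choose u : ℝ) := add_pow α β m
  have h2 : (α - β) ^ (2 * k) =
      ∑ w ∈ range (2 * k + 1), (-α) ^ w * β ^ (2 * k - w) * ((2 * k).choose w : ℝ) := by
    rw [← add_pow, show -α + β = -(α - β) by ring, Even.neg_pow (even_two_mul k)]
  rw [h1, h2, Finset.sum_mul_sum]
  refine Finset.sum_congr rfl fun u _ => Finset.sum_congr rfl fun w _ => ?_
  rw [neg_pow, pow_add, pow_add]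
  ring

/-- **`(x∂ₓ + y∂_y)^m (x∂ₓ - y∂_y)^{2k}` is diagonal on the Legendre monomials with a non-negative
eigenvalue**: for `0 < x < 1`, `j ≤ E`, `m + 2k ≤ N`,
`Σ_{a,b ≤ N} eulerRapidityWeight x m k a b · taylorCoeffAt x x (a,b) 𝒫_{E,j} = x^E · E^m · hMoment k j`
(with `hMoment k j ≥ 0`, `hMoment_nonneg`). Ingredient (T4) of G1-REDUCTION.md at the level of
Taylor coefficients; the termwise/`HasSum` layer is the tree's TaylorFunctional machinery. [folklore] -/
theorem sum_eulerRapidityWeight_taylorCoeffAt_zMono {x : ℝ} (hx0 : 0 < x) (hx1 : x < 1) {E : ℝ} {j : ℕ}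
    (hEj : (j : ℝ) ≤ E) {m k N : ℕ} (hN : m + 2 * k ≤ N) :
    ∑ a ∈ range (N + 1), ∑ b ∈ range (N + 1),
        eulerRapidityWeight x m k a b * taylorCoeffAt x x (a, b) (zMono E j) =
      x ^ E * (E ^ m * hMoment k j) := by
  -- abbreviations
  set A := range (N + 1) with hA
  set U := range (m + 1) with hU
  set V := range (2 * k + 1) with hV
  set τ : ℕ → ℝ := fun i => (E - (j : ℝ)) / 2 + i with hτ
  set C : ℕ → ℕ → ℝ := fun u w => (m.choose u : ℝ) * ((2 * k).choose w : ℝ) * (-1) ^ w with hC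
  set T : ℕ → ℕ → ℕ → ℕ → ℝ := fun u w a b =>
    eulerWeight₁ x (u + w) a * eulerWeight₁ x (m - u + (2 * k - w)) b * taylorCoeffAt x x (a, b) (zMono E j) with hT
  set P : ℕ → ℕ → ℕ × ℕ → ℝ := fun u w c => τ c.1 ^ (u + w) * τ c.2 ^ (m - u + (2 * k - w)) with hP
  -- the product identity for each (u, w)
  have hstep : ∀ u ∈ U, ∀ w ∈ V, ∑ a ∈ A, ∑ b ∈ A, T u w a b =
      x ^ E * ∑ c ∈ antidiagonal j, legendreLam c.1 * legendreLam c.2 * P u w c := by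
    intro u hu w hw
    simp only [hU, hV, Finset.mem_range] at hu hw
    exact sum_eulerWeight₁_prod_taylorCoeffAt_zMono hx0 hx1 hEj (by omega) (by omega)
  calc ∑ a ∈ A, ∑ b ∈ A, eulerRapidityWeight x m k a b * taylorCoeffAt x x (a, b) (zMono E j)
      = ∑ a ∈ A, ∑ b ∈ A, ∑ u ∈ U, ∑ w ∈ V, C u w * T u w a b := by
        refine Finset.sum_congr rfl fun a _ => Finset.sum_congr rfl fun b _ => ?_
        rw [eulerRapidityWeight, Finset.sum_mul]
        refine Finset.sum_congr rfl fun u _ => ?_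
        rw [Finset.sum_mul]
        refine Finset.sum_congr rfl fun w _ => ?_
        simp only [hC, hT]
        ring
    _ = ∑ u ∈ U, ∑ w ∈ V, ∑ a ∈ A, ∑ b ∈ A, C u w * T u w a b := by
        calc ∑ a ∈ A, ∑ b ∈ A, ∑ u ∈ U, ∑ w ∈ V, C u w * T u w a b
            = ∑ a ∈ A, ∑ u ∈ U, ∑ b ∈ A, ∑ w ∈ V, C u w * T u w a b :=
              Finset.sum_congr rfl fun a _ => Finset.sum_comm
          _ = ∑ u ∈ U, ∑ a ∈ A, ∑ b ∈ A, ∑ w ∈ V, C u w * T u w a b := Finset.sum_comm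
          _ = ∑ u ∈ U, ∑ a ∈ A, ∑ w ∈ V, ∑ b ∈ A, C u w * T u w a b :=
              Finset.sum_congr rfl fun u _ => Finset.sum_congr rfl fun a _ => Finset.sum_comm
          _ = ∑ u ∈ U, ∑ w ∈ V, ∑ a ∈ A, ∑ b ∈ A, C u w * T u w a b :=
              Finset.sum_congr rfl fun u _ => Finset.sum_comm
    _ = ∑ u ∈ U, ∑ w ∈ V, C u w * (x ^ E * ∑ c ∈ antidiagonal j, legendreLam c.1 * legendreLam c.2 * P u w c) := by
        refine Finset.sum_congr rfl fun u hu => Finset.sum_congr rfl fun w hw => ?_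
        rw [← hstep u hu w hw, Finset.mul_sum]
        refine Finset.sum_congr rfl fun a _ => ?_
        rw [Finset.mul_sum]
    _ = x ^ E * ∑ u ∈ U, ∑ w ∈ V, ∑ c ∈ antidiagonal j, legendreLam c.1 * legendreLam c.2 * (C u w * P u w c) := by
        simp only [Finset.mul_sum]
        refine Finset.sum_congr rfl fun u _ => Finset.sum_congr rfl fun w _ => Finset.sum_congr rfl fun c _ => ?_
        ring
    _ = x ^ E * ∑ c ∈ antidiagonal j, ∑ u ∈ U, ∑ w ∈ V, legendreLam c.1 * legendreLam c.2 * (C u w * P u w c) := by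
        congr 1
        calc ∑ u ∈ U, ∑ w ∈ V, ∑ c ∈ antidiagonal j, legendreLam c.1 * legendreLam c.2 * (C u w * P u w c)
            = ∑ u ∈ U, ∑ c ∈ antidiagonal j, ∑ w ∈ V, legendreLam c.1 * legendreLam c.2 * (C u w * P u w c) :=
              Finset.sum_congr rfl fun u _ => Finset.sum_comm
          _ = ∑ c ∈ antidiagonal j, ∑ u ∈ U, ∑ w ∈ V, legendreLam c.1 * legendreLam c.2 * (C u w * P u w c) :=
              Finset.sum_comm
    _ = x ^ E * ∑ c ∈ antidiagonal j, legendreLam c.1 * legendreLam c.2 * ∑ u ∈ U, ∑ w ∈ V, C u w * P u w c := by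
        congr 1
        refine Finset.sum_congr rfl fun c _ => ?_
        rw [Finset.mul_sum]
        refine Finset.sum_congr rfl fun u _ => ?_
        rw [Finset.mul_sum]
    _ = x ^ E * (E ^ m * hMoment k j) := by
        congr 1
        rw [hMoment, Finset.mul_sum]
        refine Finset.sum_congr rfl fun c hc => ?_
        have hcw : ∑ u ∈ U, ∑ w ∈ V, C u w * P u w c = (τ c.1 + τ c.2) ^ m * (τ c.1 - τ c.2) ^ (2 * k) := by
          simp only [hU, hV, hC, hP]
          exact sum_choose_mul_pow_eq m k (τ c.1) (τ c.2)
        have hsum : τ c.1 + τ c.2 = E := by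
          have h := mem_antidiagonal.mp hc
          have : ((c.1 : ℝ) + c.2) = j := by exact_mod_cast h
          simp only [hτ]
          linarith
        have hdiff : τ c.1 - τ c.2 = (c.1 : ℝ) - c.2 := by simp only [hτ]; ring
        rw [hcw, hsum, hdiff]
        ring

end Summit.CriticalPhenomena.Ising3D
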